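import Literature.Probability.Percolation.SlabGluingFact2Connector
import HarnessLib

/-!
# DST 2016, §2.3, Fact 2 — connector surgeries at the end of `γ_min`

Topic: `Literature/Probability/Percolation`. Towards the verbatim discharge of
`DuminilCopinSidoraviciusTassion2016_fact2` (`SlabGluing.lean`): instances of the connector surgery of
`SlabGluingFact2Connector.lean` attached at the LAST vertex `e` of `γ_min(ω)` (where DST's order
condition is vacuous), for the points of `U(ω)` near the end of `γ_min(ω)` at which the box surgery
(`GlueGeom.Surgery`) is unavailable:

* `GlueGeom.exists_connector_of_corridor` — PROVED: a lattice corridor `C` from a neighbour of `e`,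
  off `γ_min(ω)`, off `S̄_{3n}` and off `S̄'_n`, inside the window, meeting a (P2)-witness path `π`
  (an `ω`-open self-avoiding path to `S̄'_n` inside `B̄'_n` off the columns of `γ_min(ω)`), yields a
  `Connector` with `g = e` and interior inside `C`: cut `C` at its first vertex `π_j` on `π`, take
  `I = C_{<j} ++ [π_j]`, `x₁ = π_{j+1}`, `σ = π_{≥ j+1}`;
* `GlueGeom.eq_getLast_of_mem_zSeg` — PROVED: `γ_min(ω)` meets `Z̄_n` only at its last vertex;
* `GlueGeom.exists_surgOut_end_adj` — PROVED: a witness over a column LATTICE-ADJACENT to the column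
  of `e` gives a located surgery output at `planar(e)` (corridor: the step from `e` into that column
  — a column off those of `γ_min` — then vertically to the witness);
* `GlueGeom.exists_surgOut_end_Z` — PROVED: a witness in `Z̄_n` within `R` rows of `e` gives a
  located surgery output of radius `R` at `planar(e)` (corridor inside `Z̄_n`, which `γ_min` meets
  only at `e`, along the row direction at the height of `e`, then vertically).

## Sources

* H. Duminil-Copin, V. Sidoravicius, V. Tassion, *Absence of infinite cluster for critical
  Bernoulli percolation on slabs*, CPAM 69 (2016), arXiv:1401.7130, §2.3, proof of Fact 2
  (pp. 6–7).
* C. M. Newman, V. Tassion, W. Wu, *Critical percolation and the minimal spanning tree in slabs*,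
  CPAM 70 (2017), §3.2, proof of Thm. 3.9 [NewmanTassionWu2017].
-/

noncomputable section

namespace Literature.Probability.Percolation

open LatticeModels SimpleGraph

variable {k : ℕ}

namespace GlueGeom

variable {G : GlueGeom} {ω : BondConfig (slab 3 k)}

/-! ## The connector from a corridor -/

/-- PROVED — **a connector from a corridor meeting a witness path.** For `ω ∈ 𝒳` a lattice
configuration with `e` the last vertex of `γ_min(ω)`: a non-empty lattice corridor `C` with `e :: C`
a self-avoiding lattice chain, `C` off `γ_min(ω)`, inside `\overline{B_{3n} ∪ B'_n}`, off `S̄_{3n}` and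
off `S̄'_n`, meeting an `ω`-open self-avoiding path `π` to `S̄'_n` inside `B̄'_n` off the columns of
`γ_min(ω)`, yields connector data attached at `e` whose interior lies in `C`.
[cite: DuminilCopinSidoraviciusTassion2016, §2.3, proof of Fact 2 (pp. 6–7)] -/
theorem exists_connector_of_corridor (hω : ω ⊆ (slabGraph 3 k).edgeSet) (hX : ω ∈ G.evX k)
    {C : List (slab 3 k)}
    (hchain : ((G.γmin k ω).getLast (G.γmin_spec k hX.1.1.1).1.ne_nil :: C).IsChain
      (fun a b => (slabGraph 3 k).Adj a b))
    (hnodup : ((G.γmin k ω).getLast (G.γmin_spec k hX.1.1.1).1.ne_nil :: C).Nodup)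
    (hCγ : ∀ x ∈ C, x ∉ G.γmin k ω) (hCreg : ∀ x ∈ C, x ∈ slabLift k (G.big ∪ G.small))
    (hCsrc : ∀ x ∈ C, x ∉ slabLift k G.src) (hCsrc' : ∀ x ∈ C, x ∉ slabLift k G.src')
    {π : List (slab 3 k)} {x₀ s' : slab 3 k} (hs' : s' ∈ slabLift k G.src')
    (hπO : IsOSAP k ω (slabLift k G.small ∩ {v | planar k v ∉ G.γcols k ω}) {x₀} {s'} π)
    (hmeet : ∃ x ∈ C, x ∈ π) :
    ∃ cn : G.Connector k ω, cn.g = (G.γmin k ω).getLast (G.γmin_spec k hX.1.1.1).1.ne_nil ∧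
      ∀ x ∈ cn.I, x ∈ C := by
  have hA : ω ∈ G.evA k := hX.1.1.1
  have hγO := (G.γmin_spec k hA).1
  set γ := G.γmin k ω with hγdef
  set e := γ.getLast hγO.ne_nil with he
  -- the first vertex of the corridor on `π`
  obtain ⟨C₁, v, C₂, hCeq, hvπ, hC₁π⟩ := exists_first_split (p := fun x => x ∈ π) C hmeet
  obtain ⟨πa, πb, hπeq⟩ := List.append_of_mem hvπ
  have hvC : v ∈ C := by rw [hCeq]; simp
  have hπnd := hπO.nodup
  have hπb : πb ≠ [] := by
    rintro rfl
    have hlast := hπO.last_mem hπO.ne_nil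
    rw [Set.mem_singleton_iff] at hlast
    have : π.getLast hπO.ne_nil = v := by
      rw [List.getLast_congr _ (by simp) hπeq]; simp
    rw [this] at hlast
    exact hCsrc' v hvC (hlast ▸ hs')
  obtain ⟨x₁, πbt, rfl⟩ := List.exists_cons_of_ne_nil hπb
  have hπOsub : ∀ x ∈ π, x ∈ slabLift k G.small ∩ {v | planar k v ∉ G.γcols k ω} := hπO.subset
  have hπγ : ∀ x ∈ π, x ∉ γ := fun x hx hxγ => (hπOsub x hx).2 ⟨x, hxγ, rfl⟩
  have hx₁π : x₁ ∈ π := by rw [hπeq]; simp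
  have hvx₁ : v ≠ x₁ := by
    intro h
    rw [hπeq] at hπnd
    have := (List.nodup_append.1 hπnd).2.1
    rw [List.nodup_cons] at this
    exact this.1 (by rw [h]; exact List.mem_cons_self)
  have hvπb : v ∉ x₁ :: πbt := by
    intro h
    rw [hπeq] at hπnd
    exact (List.nodup_cons.1 (List.nodup_append.1 hπnd).2.1).1 h
  -- the chain `e :: C₁ ++ [v]` and its link to `x₁`
  have hch1 : (e :: (C₁ ++ [v])).IsChain (fun a b => (slabGraph 3 k).Adj a b) := by
    have : e :: C = (e :: (C₁ ++ [v])) ++ C₂ := by rw [hCeq]; simp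
    rw [this, List.isChain_append] at hchain
    exact hchain.1
  have hnd1 : (e :: (C₁ ++ [v])).Nodup := by
    have : e :: C = (e :: (C₁ ++ [v])) ++ C₂ := by rw [hCeq]; simp
    rw [this] at hnodup
    exact hnodup.sublist (List.sublist_append_left _ _)
  have hlink : s(v, x₁) ∈ ω ∧ v ≠ x₁ := by
    have hch := hπO.chain
    rw [hπeq, List.isChain_append] at hch
    obtain ⟨-, h2, -⟩ := hch
    exact List.isChain_cons_cons.1 h2 |>.1
  refine ⟨⟨e, C₁ ++ [v], x₁, x₁ :: πbt, List.getLast_mem _, by simp, ?_, ?_,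
    fun x hx => hCreg x ?_, fun x hx => hCγ x ?_, ?_, fun x hx => hCsrc x ?_, ?_,
    rfl, ?_, ?_, ?_⟩, rfl, fun x hx => ?_⟩
  · -- chain
    have : e :: ((C₁ ++ [v]) ++ [x₁]) = (e :: (C₁ ++ [v])) ++ [x₁] := by simp
    rw [this]
    refine List.IsChain.append hch1 (List.isChain_singleton _) fun x hx y hy => ?_
    have hx' : x = v := by
      rw [show e :: (C₁ ++ [v]) = (e :: C₁) ++ [v] by simp, List.getLast?_concat] at hx
      simpa using hx.symm
    have hy' : y = x₁ := by simpa using hy.symm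
    subst hx' hy'
    exact (SimpleGraph.mem_edgeSet _).1 (hω hlink.1)
  · -- nodup
    have : e :: ((C₁ ++ [v]) ++ [x₁]) = (e :: (C₁ ++ [v])) ++ [x₁] := by simp
    rw [this, List.nodup_append]
    refine ⟨hnd1, List.nodup_singleton _, fun a ha b hb => ?_⟩
    rw [List.mem_singleton] at hb
    subst hb
    rintro rfl
    rcases List.mem_cons.1 ha with h | h
    · exact hπγ _ hx₁π (h ▸ List.getLast_mem _)
    · rcases List.mem_append.1 h with h | h
      · exact hC₁π _ h hx₁π
      · simp only [List.mem_singleton] at h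
        exact hvx₁ h.symm
  · rcases List.mem_append.1 hx with h | h
    · rw [hCeq]; exact List.mem_append_left _ h
    · simp only [List.mem_singleton] at h; rw [h]; exact hvC
  · rcases List.mem_append.1 hx with h | h
    · rw [hCeq]; exact List.mem_append_left _ h
    · simp only [List.mem_singleton] at h; rw [h]; exact hvC
  · -- interior off `σ = πb`
    intro x hx hxσ
    rcases List.mem_append.1 hx with h | h
    · exact hC₁π x h (by rw [hπeq]; simp [hxσ])
    · simp only [List.mem_singleton] at h
      exact hvπb (h ▸ hxσ)
  · rcases List.mem_append.1 hx with h | h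
    · rw [hCeq]; exact List.mem_append_left _ h
    · simp only [List.mem_singleton] at h; rw [h]; exact hvC
  · -- the order condition is vacuous at the last vertex
    intro l₁ l₂ y hγeq
    change γ = _ at hγeq
    exfalso
    have hnd := hγO.nodup
    have hlast : γ.getLast hγO.ne_nil ∈ y :: l₂ := by
      rw [List.getLast_congr _ (by simp) hγeq, List.getLast_append_of_ne_nil _ (by simp),
        List.getLast_cons (by simp)]
      exact List.getLast_mem _
    rw [hγeq] at hnd
    exact (List.nodup_cons.1 (List.nodup_append.1 hnd).2.1).1 hlast
  · -- `σ` is `ω`-open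
    have hch := hπO.chain
    rw [hπeq, List.isChain_append] at hch
    exact (List.isChain_cons.1 hch.2.1).2
  · intro x hx
    exact (hπOsub x (by rw [hπeq]; simp [hx])).1
  · intro h
    have hlast := hπO.last_mem hπO.ne_nil
    rw [Set.mem_singleton_iff] at hlast
    have : π.getLast hπO.ne_nil = (x₁ :: πbt).getLast h := by
      rw [List.getLast_congr _ (by simp) hπeq, List.getLast_append_of_ne_nil _ (List.cons_ne_nil _ _),
        List.getLast_cons_cons]
    rw [← this, hlast]; exact hs'
  · change x ∈ C₁ ++ [v] at hx
    rcases List.mem_append.1 hx with h | h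
    · rw [hCeq]; exact List.mem_append_left _ h
    · simp only [List.mem_singleton] at h; rw [h]; exact hvC

/-! ## The end of `γ_min` -/

/-- **`γ_min(ω)` meets `Z̄_n` only at its last vertex** (a proper prefix ending in `Z̄_n` would be a
smaller admissible path). [folklore] -/
theorem eq_getLast_of_mem_zSeg (hA : ω ∈ G.evA k) {v : slab 3 k} (hv : v ∈ G.γmin k ω)
    (hvZ : planar k v ∈ G.zSeg) : v = (G.γmin k ω).getLast (G.γmin_spec k hA).1.ne_nil := by
  have hγO := (G.γmin_spec k hA).1
  obtain ⟨l₁, l₂, hγeq⟩ := List.append_of_mem hv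
  by_cases hl₂ : l₂ = []
  · subst hl₂
    rw [List.getLast_congr _ (by simp) hγeq]; simp
  · exfalso
    have hS := G.big_finite k
    have hex : ∃ l, IsOSAP k ω (slabLift k G.big) (slabLift k G.src) (slabLift k G.zSeg) l :=
      (mem_slabConn_iff_exists_isOSAP ω _ _ _).1 hA
    have h := minPath_prefix_getLast_not_mem hS hex (p := l₁ ++ [v]) (s := l₂)
      (by change G.γmin k ω = _; rw [hγeq]; simp) hl₂ (by simp)
    simp only [List.getLast_append_of_ne_nil _ (List.cons_ne_nil _ _), List.getLast_singleton,
      mem_slabLift_iff] at h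
    exact h hvZ

/-- The last vertex of `γ_min(ω)` lies in `Z̄_n`. [folklore] -/
theorem getLast_mem_zSeg (hA : ω ∈ G.evA k) :
    planar k ((G.γmin k ω).getLast (G.γmin_spec k hA).1.ne_nil) ∈ G.zSeg :=
  (G.γmin_spec k hA).1.last_mem _

/-! ## Connectors at the end of `γ_min` -/

section EndInstances

/-- Bookkeeping shared by the two instances: coordinates of the end `e` of `γ_min(ω)` and of a
witness column `q₀` in `B'_n` to the right of `x = 3n - 2`: `e` lies in the column `3n`, `q₀` is
off `S_{3n}` and off `S'_n`. [folklore] -/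
theorem end_coords (hG : G.InRange) (hA : ω ∈ G.evA k) {q₀ : ℤ × ℤ} (hq₀s : q₀ ∈ G.small)
    (hq₀1 : 3 * (G.n : ℤ) - 1 ≤ q₀.1) :
    (planar k ((G.γmin k ω).getLast (G.γmin_spec k hA).1.ne_nil)).1 = 3 * G.n ∧
      q₀ ∉ G.src ∧ q₀ ∉ G.src' := by
  obtain ⟨hn, hu₃, hu₁, hα, hαn, hy0, hy⟩ := hG
  have heZ := G.getLast_mem_zSeg (k := k) (ω := ω) hA
  simp only [zSeg, sideSeg, Set.mem_setOf_eq] at heZ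
  simp only [small, sqBox, Set.mem_setOf_eq, abs_le] at hq₀s
  refine ⟨heZ.1, ?_, ?_⟩
  · simp only [src, sqBox, Set.mem_setOf_eq, abs_le, Prod.fst_zero, Prod.snd_zero, sub_zero, not_and]
    intro h; omega
  · simp only [src', sqBox, Set.mem_setOf_eq, abs_le, not_and]
    intro h; omega

/-- PROVED — **located surgery at the end of `γ_min`, witness column lattice-adjacent**: for
`ω ∈ 𝒳` a lattice configuration, if a (P2)-witness `x₀` (joined to `S̄'_n` inside `B̄'_n` off the
columns of `γ_min(ω)`) lies over a planar lattice neighbour of `planar(e)`, `e` the last vertex of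
`γ_min(ω)`, then a located surgery output of radius `1` at `planar(e)` exists (corridor: `e`, then
the column of `x₀` from the height of `e` to `x₀`). [cite: DuminilCopinSidoraviciusTassion2016, §2.3, proof of Fact 2 (pp. 6–7)] -/
theorem exists_surgOut_end_adj (hG : G.InRange) (hω : ω ⊆ (slabGraph 3 k).edgeSet) (hX : ω ∈ G.evX k)
    {x₀ s' : slab 3 k} (hs' : s' ∈ slabLift k G.src')
    (hπ : ω ∈ openConnIn (slabLift k G.small ∩ {v | planar k v ∉ G.γcols k ω}) x₀ s')
    (hadj : planarAdj (planar k ((G.γmin k ω).getLast (G.γmin_spec k hX.1.1.1).1.ne_nil)) (planar k x₀)) :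
    ∃ ω', G.SurgOut k 1 ω (planar k ((G.γmin k ω).getLast (G.γmin_spec k hX.1.1.1).1.ne_nil)) ω' := by
  have hA : ω ∈ G.evA k := hX.1.1.1
  have hγO := (G.γmin_spec k hA).1
  set γ := G.γmin k ω with hγdef
  set e := γ.getLast hγO.ne_nil with he_def
  set q₀ := planar k x₀ with hq₀
  obtain ⟨hx₀S, hs'S, hreach⟩ := hπ
  have hq₀s : q₀ ∈ G.small := hx₀S.1
  have hq₀γ : q₀ ∉ G.γcols k ω := hx₀S.2
  have heq₀ : planar k e ≠ q₀ := fun h => hq₀γ ⟨e, List.getLast_mem _, h⟩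
  have hq₀near : q₀ ∈ sqBox (planar k e) 1 := mem_sqBox_one_of_planarAdj (planarAdj_symm hadj)
  have hq₀1 : 3 * (G.n : ℤ) - 1 ≤ q₀.1 := by
    have heZ : planar k e ∈ G.zSeg := G.getLast_mem_zSeg hA
    simp only [zSeg, sideSeg, Set.mem_setOf_eq] at heZ
    have := hq₀near
    simp only [sqBox, Set.mem_setOf_eq, abs_le, Nat.cast_one] at this
    omega
  obtain ⟨-, hq₀src, hq₀src'⟩ := G.end_coords (k := k) (ω := ω) hG hA hq₀s hq₀1
  -- the corridor: the column of `x₀` from the height of `e` to `x₀`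
  have hhe : ht e ≤ k := ht_le e
  have hh' : ht x₀ ≤ k := ht_le x₀
  have hC := vline_spath (k := k) q₀ hhe hh'
  rw [show vtx k q₀ (ht x₀) = x₀ from vtx_planar_ht x₀] at hC
  have hmemC : ∀ v ∈ vline k q₀ (ht e) (ht x₀), planar k v = q₀ := fun v hv =>
    ((mem_vline_iff hhe hh' v).1 hv).1
  obtain ⟨π, hπO⟩ := exists_isOSAP_of_openConnIn
    (show ω ∈ openConnIn (slabLift k G.small ∩ {v | planar k v ∉ G.γcols k ω}) x₀ s' from ⟨hx₀S, hs'S, hreach⟩)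
  have hx₀π : x₀ ∈ π := by
    have := hπO.head_mem hπO.ne_nil
    rw [Set.mem_singleton_iff] at this
    rw [← this]; exact List.head_mem _
  have hcn := G.exists_connector_of_corridor hω hX (C := vline k q₀ (ht e) (ht x₀))
    ?_ ?_ (fun x hx hxγ => hq₀γ ⟨x, hxγ, hmemC x hx⟩)
    (fun x hx => by rw [mem_slabLift_iff, hmemC x hx]; exact Or.inr hq₀s)
    (fun x hx h => hq₀src (by rw [mem_slabLift_iff, hmemC x hx] at h; exact h))
    (fun x hx h => hq₀src' (by rw [mem_slabLift_iff, hmemC x hx] at h; exact h))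
    hs' hπO ⟨x₀, hC.last_mem, hx₀π⟩
  · obtain ⟨cn, hcng, hcnI⟩ := hcn
    have hg3 : planar k cn.g ∈ sqBox (planar k e) 3 := by
      rw [hcng]; change planar k e ∈ sqBox (planar k e) 3; simp [sqBox]
    have hIr : ∀ x ∈ cn.I, planar k x ∈ sqBox (planar k e) 1 := fun x hx => by
      rw [hmemC x (hcnI x hx)]; exact hq₀near
    exact ⟨_, cn.surgOut hX hg3 hIr⟩
  · -- `e :: C` is a lattice chain
    rw [List.isChain_cons]
    refine ⟨fun y hy => ?_, hC.chain⟩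
    rw [hC.head, Option.mem_def, Option.some.injEq] at hy
    subst hy
    have := vtx_adj_vtx_planar (k := k) hadj (ht e)
    rwa [vtx_planar_ht] at this
  · -- and self-avoiding
    rw [List.nodup_cons]
    exact ⟨fun h => heq₀ (hmemC _ h), hC.nodup⟩

/-- PROVED — **located surgery at the end of `γ_min`, witness in `Z̄_n` within `R` rows**: for
`ω ∈ 𝒳` a lattice configuration, if a (P2)-witness `x₀` lies in `Z̄_n` within `R` rows of the last
vertex `e` of `γ_min(ω)`, then a located surgery output of radius `R` at `planar(e)` exists
(corridor inside `Z̄_n`, which `γ_min(ω)` meets only at `e`: along the column `x = 3n` at the height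
of `e` to the row of `x₀`, then vertically to `x₀`). [cite: DuminilCopinSidoraviciusTassion2016, §2.3, proof of Fact 2 (pp. 6–7)] -/
theorem exists_surgOut_end_Z (hG : G.InRange) (hω : ω ⊆ (slabGraph 3 k).edgeSet) (hX : ω ∈ G.evX k)
    {x₀ s' : slab 3 k} (hs' : s' ∈ slabLift k G.src')
    (hπ : ω ∈ openConnIn (slabLift k G.small ∩ {v | planar k v ∉ G.γcols k ω}) x₀ s')
    (hx₀Z : planar k x₀ ∈ G.zSeg) {R : ℕ}
    (hR : |(planar k x₀).2 - (planar k ((G.γmin k ω).getLast (G.γmin_spec k hX.1.1.1).1.ne_nil)).2| ≤ R) :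
    ∃ ω', G.SurgOut k R ω (planar k ((G.γmin k ω).getLast (G.γmin_spec k hX.1.1.1).1.ne_nil)) ω' := by
  have hA : ω ∈ G.evA k := hX.1.1.1
  have hγO := (G.γmin_spec k hA).1
  obtain ⟨hn, hu₃, hu₁, hα, hαn, hy0, hy⟩ := id hG
  set γ := G.γmin k ω with hγdef
  set e := γ.getLast hγO.ne_nil with he_def
  set q₀ := planar k x₀ with hq₀
  obtain ⟨hx₀S, hs'S, hreach⟩ := hπ
  have hq₀s : q₀ ∈ G.small := hx₀S.1
  have hq₀γ : q₀ ∉ G.γcols k ω := hx₀S.2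
  have heZ := G.getLast_mem_zSeg (k := k) (ω := ω) hA
  have heb : planar k e ∈ G.big := hγO.subset e (List.getLast_mem _)
  have heq₀ : planar k e ≠ q₀ := fun h => hq₀γ ⟨e, List.getLast_mem _, h⟩
  -- coordinates: `e = (3n, r)`, `q₀ = (3n, r₀)`, `r ≠ r₀`
  set r := (planar k e).2 with hr
  set r₀ := q₀.2 with hr₀
  have he1 : (planar k e).1 = 3 * G.n := by
    simp only [zSeg, sideSeg, Set.mem_setOf_eq] at heZ; exact heZ.1
  have hq₀1 : q₀.1 = 3 * G.n := by
    have := hx₀Z; simp only [zSeg, sideSeg, Set.mem_setOf_eq] at this; exact this.1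
  have hq₀eq : q₀ = (3 * (G.n : ℤ), r₀) := Prod.ext hq₀1 rfl
  have heeq : planar k e = (3 * (G.n : ℤ), r) := Prod.ext he1 rfl
  have hrr₀ : r ≠ r₀ := fun h => heq₀ (by rw [heeq, hq₀eq, h])
  have hrZ : G.y - G.α ≤ r ∧ r ≤ G.y + G.α := by
    simp only [zSeg, sideSeg, Set.mem_setOf_eq] at heZ; exact heZ.2
  have hr₀Z : G.y - G.α ≤ r₀ ∧ r₀ ≤ G.y + G.α := by
    have := hx₀Z; simp only [zSeg, sideSeg, Set.mem_setOf_eq] at this; exact this.2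
  have hrb : -(3 * (G.n : ℤ)) ≤ r ∧ r ≤ 3 * G.n := by
    simp only [big, sqBox, Set.mem_setOf_eq, abs_le, Prod.snd_zero, sub_zero] at heb; exact heb.2
  have hr₀s : G.y - G.n ≤ r₀ ∧ r₀ ≤ G.y + G.n := by
    simp only [small, sqBox, Set.mem_setOf_eq, abs_le] at hq₀s; constructor <;> omega
  obtain ⟨-, hq₀src, hq₀src'⟩ := G.end_coords (k := k) (ω := ω) hG hA hq₀s (by omega)
  -- the planar piece inside `Z_n`: rows from `r₁` (next to `r`, towards `r₀`) to `r₀`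
  obtain ⟨r₁, hr₁facts⟩ : ∃ r₁ : ℤ, (r₁ = r + 1 ∧ r < r₀) ∨ (r₁ = r - 1 ∧ r₀ < r) := by
    rcases lt_or_gt_of_ne hrr₀ with h | h
    · exact ⟨r + 1, Or.inl ⟨rfl, h⟩⟩
    · exact ⟨r - 1, Or.inr ⟨rfl, h⟩⟩
  have hr₁adj : planarAdj (planar k e) (3 * (G.n : ℤ), r₁) := by
    rw [heeq, planarAdj]
    rcases hr₁facts with ⟨h1, -⟩ | ⟨h1, -⟩
    · rw [h1]; right; left; ext <;> simp
    · rw [h1]; right; right; ext <;> simp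
  obtain ⟨lpl, hlpl, hlplm⟩ := exists_vpath (3 * (G.n : ℤ)) r₁ r₀
  have hrows : ∀ q ∈ lpl, q.1 = 3 * G.n ∧ q.2 ≠ r ∧
      G.y - G.α ≤ q.2 ∧ q.2 ≤ G.y + G.α ∧ min r r₀ ≤ q.2 ∧ q.2 ≤ max r r₀ := by
    intro q hq
    obtain ⟨h1, h2, h3⟩ := (hlplm q).1 hq
    simp only [min_le_iff, le_max_iff] at h2 h3 ⊢
    rcases hr₁facts with ⟨h4, h5⟩ | ⟨h4, h5⟩ <;> rw [h4] at h2 h3 <;> refine ⟨h1, ?_, ?_, ?_, ?_, ?_⟩ <;> omega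
  have hhe : ht e ≤ k := ht_le e
  have hh' : ht x₀ ≤ k := ht_le x₀
  have hXp := liftH_spath (k := k) hlpl (ht e)
  rw [← hq₀eq] at hXp
  have hYp := vline_spath (k := k) q₀ hhe hh'
  rw [show vtx k q₀ (ht x₀) = x₀ from vtx_planar_ht x₀] at hYp
  have hmemX : ∀ v ∈ liftH k (ht e) lpl, planar k v ∈ lpl ∧ ht v = ht e := fun v hv =>
    (mem_liftH_iff hhe v).1 hv
  have hmemY : ∀ v ∈ vline k q₀ (ht e) (ht x₀), planar k v = q₀ := fun v hv =>
    ((mem_vline_iff hhe hh' v).1 hv).1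
  obtain ⟨hC, hmemC⟩ := hXp.trans hYp fun v hvX hvY => by
    obtain ⟨-, hvh⟩ := hmemX v hvX
    exact (slab_ext_iff _ _).2 ⟨by rw [planar_vtx]; exact hmemY v hvY, by rw [ht_vtx hhe]; exact hvh⟩
  set C := liftH k (ht e) lpl ++ (vline k q₀ (ht e) (ht x₀)).tail with hCdef
  -- planar bookkeeping along the corridor
  have hplan : ∀ v ∈ C, (planar k v).1 = 3 * G.n ∧ (planar k v).2 ≠ r ∧
      G.y - G.n ≤ (planar k v).2 ∧ (planar k v).2 ≤ G.y + G.n ∧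
      min r r₀ ≤ (planar k v).2 ∧ (planar k v).2 ≤ max r r₀ := by
    intro v hv
    rcases (hmemC v).1 hv with h | h
    · obtain ⟨h1, h2, h4, h5, h6, h7⟩ := hrows _ (hmemX v h).1
      exact ⟨h1, h2, by omega, by omega, h6, h7⟩
    · rw [hmemY v h, hq₀eq]
      refine ⟨rfl, fun h => hrr₀ h.symm, hr₀s.1, hr₀s.2, min_le_right _ _, le_max_right _ _⟩
  obtain ⟨π, hπO⟩ := exists_isOSAP_of_openConnIn
    (show ω ∈ openConnIn (slabLift k G.small ∩ {v | planar k v ∉ G.γcols k ω}) x₀ s' from ⟨hx₀S, hs'S, hreach⟩)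
  have hx₀π : x₀ ∈ π := by
    have := hπO.head_mem hπO.ne_nil
    rw [Set.mem_singleton_iff] at this
    rw [← this]; exact List.head_mem _
  have hcn := G.exists_connector_of_corridor hω hX (C := C) ?_ ?_ ?_ ?_ ?_ ?_ hs' hπO
    ⟨x₀, hC.last_mem, hx₀π⟩
  · obtain ⟨cn, hcng, hcnI⟩ := hcn
    have hg3 : planar k cn.g ∈ sqBox (planar k e) 3 := by
      rw [hcng]; change planar k e ∈ sqBox (planar k e) 3; simp [sqBox]
    have hIr : ∀ x ∈ cn.I, planar k x ∈ sqBox (planar k e) R := fun x hx => by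
      obtain ⟨h1, -, -, -, h6, h7⟩ := hplan x (hcnI x hx)
      simp only [sqBox, Set.mem_setOf_eq, h1, he1, sub_self, abs_zero, Nat.cast_nonneg, true_and]
      rw [abs_le] at hR ⊢
      simp only [min_le_iff, le_max_iff] at h6 h7
      constructor <;> omega
    exact ⟨_, cn.surgOut hX hg3 hIr⟩
  · -- `e :: C` is a lattice chain
    rw [List.isChain_cons]
    refine ⟨fun y hy => ?_, hC.chain⟩
    rw [hC.head, Option.mem_def, Option.some.injEq] at hy
    subst hy
    have := vtx_adj_vtx_planar (k := k) hr₁adj (ht e)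
    rwa [vtx_planar_ht] at this
  · -- and self-avoiding
    rw [List.nodup_cons]
    exact ⟨fun h => (hplan e h).2.1 rfl, hC.nodup⟩
  · -- off `γ_min`: inside `Z̄_n` a vertex of `γ_min` is `e`; the column of `x₀` is off `γ_min`
    intro v hv hvγ
    rcases (hmemC v).1 hv with h | h
    · obtain ⟨h1, h2, h4, h5, -⟩ := hrows _ (hmemX v h).1
      have hvZ : planar k v ∈ G.zSeg := by
        simp only [zSeg, sideSeg, Set.mem_setOf_eq]; exact ⟨h1, h4, h5⟩
      have := G.eq_getLast_of_mem_zSeg hA hvγ hvZ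
      exact h2 (by rw [this])
    · exact hq₀γ ⟨v, hvγ, hmemY v h⟩
  · -- inside the window
    intro v hv
    obtain ⟨h1, -, h4, h5, h6, h7⟩ := hplan v hv
    rw [mem_slabLift_iff]
    simp only [big, small, sqBox, Set.mem_union, Set.mem_setOf_eq, abs_le, Prod.fst_zero, Prod.snd_zero,
      sub_zero, h1]
    simp only [min_le_iff, le_max_iff] at h6 h7
    omega
  · -- off `S̄_{3n}`
    intro v hv h
    obtain ⟨h1, -⟩ := hplan v hv
    rw [mem_slabLift_iff] at h
    simp only [src, sqBox, Set.mem_setOf_eq, abs_le, Prod.fst_zero, Prod.snd_zero, sub_zero, h1] at h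
    omega
  · -- off `S̄'_n`
    intro v hv h
    obtain ⟨h1, -⟩ := hplan v hv
    rw [mem_slabLift_iff] at h
    simp only [src', sqBox, Set.mem_setOf_eq, abs_le, h1] at h
    omega

end EndInstances

end GlueGeom

end Literature.Probability.Percolation

end
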